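import Literature.Geometry.Lorentzian.KerrBoyerLindquistData
import HarnessLib

/-!
# Joint smoothness of the Boyer–Lindquist rest template in the Kerr parameters

The quasi-isotropic Boyer–Lindquist template of `KerrBoyerLindquist*.lean` gives, for FIXED Kerr
parameters `(M, a)` with `0 ≤ M`, the exact rest-frame Kerr end `Kerr.BL.blData hM hρ₁` on
`Kerr.slice 0 ρ₁`, whose chart coefficients are the closed forms
`h_y = Kerr.Ingoing.blHRepCLM M a y` (`KerrBoyerLindquistDecay.lean`) and
`k_y = Kerr.BL.kRepCLM M a y` (`KerrBoyerLindquistExtrinsicForm.lean`), both smooth in `y` beyond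
the threshold `‖y‖ > ρH(M, a)` (`contDiffAt_blHRepCLM`, `contDiffAt_kRepCLM`).

A receding-gluing curve uses these templates with parameters `(μ(s), a(s))` VARYING along the
curve, and the tameness bookkeeping (`SmoothSectionsOn` of the unit-scale family) then needs the
coefficient maps to be smooth JOINTLY in `(M, a, y)`. Both closed forms are rational functions of
`M`, `a`, `‖y‖`, `y₃` and `√(ΔΣ/A)` whose denominators `‖y‖`, `Σ`, `A`, `ΔΣ/A` are positive at every
point with `0 ≤ M`, `‖y‖ > ρH(M, a)`; so joint smoothness is the same chain of `ContDiffAt`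
compositions as the `y`-smoothness, run on the product space `ℝ × ℝ × E3` (`p = (M, a, y)`):

* `Kerr.BL.contDiffAt_param_qiRadius`, `…_qiRoot`, `…_sigmaE`, `…_bigA`, `…_delta_qiRadius`,
  `…_omegaE`, `…_lapseE`, `…_kOne`, `…_kTwo`, `…_dRCLM`, `…_rotFormCLM`, `…_dMuCLM`,
  `…_rotTensor` — the profile functions;
* **`Kerr.BL.contDiffAt_param_blHRepCLM`**, **`Kerr.BL.contDiffAt_param_kRepCLM`** — the two
  closed forms are `C^n` (every `n`, resp. `C^∞`) at every `(M, a, y)` with `0 ≤ M`,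
  `ρH(M, a) < ‖y‖`, as maps `ℝ × ℝ × E3 → (E3 →L[ℝ] E3 →L[ℝ] ℝ)`;
* `Kerr.BL.contDiffAt_blHRepCLM_comp`, `Kerr.BL.contDiffAt_kRepCLM_comp` — along any `C^n`
  parameter maps `q ↦ (M(q), a(q), y(q))` from a normed space (the form a curve of templates
  consumes), and `Kerr.BL.contDiffOn_param_blHRepCLM` / `…_kRepCLM` on the parameter region
  `{(M, a, y) | 0 ≤ M, ρH(M, a) < ‖y‖}`.

Everything is proved; no definitions, no named facts.

## References

* S. R. Brandt, E. Seidel, *Evolution of distorted rotating black holes. III*, Phys. Rev. D 54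
  (1996) 1403, §II (the quasi-isotropic Boyer–Lindquist 3-metric and extrinsic curvature).
  [BrandtSeidel1996]
* J. M. Bardeen, W. H. Press, S. A. Teukolsky, Astrophys. J. 178 (1972) 347, (2.3)–(2.5)
  (lapse `α = √(ΔΣ/A)`, frame dragging `ω = 2MRa/A`).
-/

noncomputable section

open scoped ContDiff InnerProductSpace
open Function

namespace Literature.Geometry.Lorentzian

namespace Kerr.BL

open Kerr.Ingoing

variable {n : WithTop ℕ∞} {p : ℝ × ℝ × E3}

/-! ### The coordinate projections of the parameter space `ℝ × ℝ × E3` -/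

/-- `p ↦ M` is smooth on `ℝ × ℝ × E3`. [folklore] -/
theorem contDiffAt_param_fst : ContDiffAt ℝ n (fun p : ℝ × ℝ × E3 ↦ p.1) p :=
  contDiffAt_fst

/-- `p ↦ a` is smooth on `ℝ × ℝ × E3`. [folklore] -/
theorem contDiffAt_param_snd_fst : ContDiffAt ℝ n (fun p : ℝ × ℝ × E3 ↦ p.2.1) p :=
  contDiffAt_id.snd.fst

/-- `p ↦ y` is smooth on `ℝ × ℝ × E3`. [folklore] -/
theorem contDiffAt_param_snd_snd : ContDiffAt ℝ n (fun p : ℝ × ℝ × E3 ↦ p.2.2) p :=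
  contDiffAt_id.snd.snd

/-- `p ↦ ‖y‖` is smooth where `y ≠ 0`. [folklore] -/
theorem contDiffAt_param_norm (hp : p.2.2 ≠ 0) :
    ContDiffAt ℝ n (fun p : ℝ × ℝ × E3 ↦ ‖p.2.2‖) p :=
  (contDiffAt_norm ℝ hp).comp p contDiffAt_param_snd_snd

/-- `p ↦ yᵢ` is smooth. [folklore] -/
theorem contDiffAt_param_proj (i : Fin 3) : ContDiffAt ℝ n (fun p : ℝ × ℝ × E3 ↦ p.2.2 i) p :=
  ((EuclideanSpace.proj (𝕜 := ℝ) i).contDiff.contDiffAt).comp p contDiffAt_param_snd_snd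

/-- `p ↦ ⟪y, ·⟫` is smooth. [folklore] -/
theorem contDiffAt_param_covec : ContDiffAt ℝ n (fun p : ℝ × ℝ × E3 ↦ E3.covec p.2.2) p :=
  ((innerSL ℝ (E := E3) : E3 →L[ℝ] E3 →L[ℝ] ℝ).contDiff.contDiffAt).comp p
    contDiffAt_param_snd_snd

/-- `p ↦ y₃/‖y‖` is smooth where `y ≠ 0`. [folklore] -/
theorem contDiffAt_param_div_norm (hp : p.2.2 ≠ 0) :
    ContDiffAt ℝ n (fun p : ℝ × ℝ × E3 ↦ p.2.2 2 / ‖p.2.2‖) p :=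
  (contDiffAt_param_proj 2).div (contDiffAt_param_norm hp) (norm_ne_zero_iff.2 hp)

/-! ### The profile functions, jointly in `(M, a, y)` -/

/-- **The quasi-isotropic radius `R = ρ + M + (M² − a²)/(4ρ)` is jointly smooth in `(M, a, y)`**
off `y = 0`. [cite: BrandtSeidel1996, §II] -/
theorem contDiffAt_param_qiRadius (hp : p.2.2 ≠ 0) :
    ContDiffAt ℝ n (fun p : ℝ × ℝ × E3 ↦ qiRadius p.1 p.2.1 ‖p.2.2‖) p := by
  have hρ : ‖p.2.2‖ ≠ 0 := norm_ne_zero_iff.2 hp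
  have hn := contDiffAt_param_norm hp (n := n)
  unfold qiRadius
  exact (hn.add contDiffAt_param_fst).add
    (((contDiffAt_param_fst.pow 2).sub (contDiffAt_param_snd_fst.pow 2)).div
      (contDiffAt_const.mul hn) (mul_ne_zero four_ne_zero hρ))

/-- `q = ρ − (M² − a²)/(4ρ)` is jointly smooth in `(M, a, y)` off `y = 0`.
[cite: BrandtSeidel1996, §II] -/
theorem contDiffAt_param_qiRoot (hp : p.2.2 ≠ 0) :
    ContDiffAt ℝ n (fun p : ℝ × ℝ × E3 ↦ qiRoot p.1 p.2.1 ‖p.2.2‖) p := by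
  have hρ : ‖p.2.2‖ ≠ 0 := norm_ne_zero_iff.2 hp
  have hn := contDiffAt_param_norm hp (n := n)
  unfold qiRoot
  exact hn.sub (((contDiffAt_param_fst.pow 2).sub (contDiffAt_param_snd_fst.pow 2)).div
    (contDiffAt_const.mul hn) (mul_ne_zero four_ne_zero hρ))

/-- `Σ = R² + a² y₃²/‖y‖²` is jointly smooth in `(M, a, y)` off `y = 0`.
[cite: BrandtSeidel1996, §II] -/
theorem contDiffAt_param_sigmaE (hp : p.2.2 ≠ 0) :
    ContDiffAt ℝ n (fun p : ℝ × ℝ × E3 ↦ sigmaE p.1 p.2.1 p.2.2) p := by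
  unfold sigmaE
  exact ((contDiffAt_param_qiRadius hp).pow 2).add
    ((contDiffAt_param_snd_fst.pow 2).mul ((contDiffAt_param_div_norm hp).pow 2))

/-- `A = (R² + a²)Σ + 2MRa²(1 − μ²)` is jointly smooth in `(M, a, y)` off `y = 0`.
[cite: BrandtSeidel1996, §II] -/
theorem contDiffAt_param_bigA (hp : p.2.2 ≠ 0) :
    ContDiffAt ℝ n (fun p : ℝ × ℝ × E3 ↦ bigA p.1 p.2.1 p.2.2) p := by
  have hR := contDiffAt_param_qiRadius hp (n := n)
  unfold bigA
  exact (((hR.pow 2).add (contDiffAt_param_snd_fst.pow 2)).mul (contDiffAt_param_sigmaE hp)).add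
    ((((contDiffAt_const.mul contDiffAt_param_fst).mul hR).mul
      (contDiffAt_param_snd_fst.pow 2)).mul
      (contDiffAt_const.sub ((contDiffAt_param_div_norm hp).pow 2)))

/-- `Δ(R) = R² − 2MR + a²` is jointly smooth in `(M, a, y)` off `y = 0`.
[cite: BrandtSeidel1996, §II] -/
theorem contDiffAt_param_delta_qiRadius (hp : p.2.2 ≠ 0) :
    ContDiffAt ℝ n (fun p : ℝ × ℝ × E3 ↦ Ingoing.delta p.1 p.2.1 (qiRadius p.1 p.2.1 ‖p.2.2‖)) p := by
  have hR := contDiffAt_param_qiRadius hp (n := n)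
  simp only [Ingoing.delta]
  exact ((hR.pow 2).sub ((contDiffAt_const.mul contDiffAt_param_fst).mul hR)).add
    (contDiffAt_param_snd_fst.pow 2)

/-- A point of the parameter region has `y ≠ 0`. [folklore] -/
theorem snd_snd_ne_zero_of_rhoH_lt (hρ : rhoH p.1 p.2.1 < ‖p.2.2‖) : p.2.2 ≠ 0 := by
  intro h0
  rw [h0, norm_zero] at hρ
  exact absurd hρ (not_lt.2 (rhoH_nonneg p.1 p.2.1))

/-- The frame-dragging velocity `ω = 2MRa/A` is jointly smooth in `(M, a, y)` on the parameter
region (`0 ≤ M`, `‖y‖ > ρH(M, a)`, where `A > 0`). [cite: BrandtSeidel1996, §II] -/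
theorem contDiffAt_param_omegaE (h0 : 0 ≤ p.1) (hρ : rhoH p.1 p.2.1 < ‖p.2.2‖) :
    ContDiffAt ℝ n (fun p : ℝ × ℝ × E3 ↦ omegaE p.1 p.2.1 p.2.2) p := by
  have hp := snd_snd_ne_zero_of_rhoH_lt hρ
  unfold omegaE
  exact (((contDiffAt_const.mul contDiffAt_param_fst).mul (contDiffAt_param_qiRadius hp)).mul
    contDiffAt_param_snd_fst).div (contDiffAt_param_bigA hp) (bigA_pos h0 hρ).ne'

/-- **The lapse `α = √(ΔΣ/A)` is jointly smooth in `(M, a, y)` on the parameter region**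
(`ΔΣ/A > 0` there). [cite: BrandtSeidel1996, §II] -/
theorem contDiffAt_param_lapseE (h0 : 0 ≤ p.1) (hρ : rhoH p.1 p.2.1 < ‖p.2.2‖) :
    ContDiffAt ℝ n (fun p : ℝ × ℝ × E3 ↦ lapseE p.1 p.2.1 p.2.2) p := by
  have hp := snd_snd_ne_zero_of_rhoH_lt hρ
  unfold lapseE
  exact (((contDiffAt_param_delta_qiRadius hp).mul (contDiffAt_param_sigmaE hp)).div
    (contDiffAt_param_bigA hp) (bigA_pos h0 hρ).ne').sqrt (lapseSq_pos h0 hρ).ne'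

/-- `k₁` is jointly smooth in `(M, a, y)` on the parameter region. [cite: BrandtSeidel1996, §II] -/
theorem contDiffAt_param_kOne (h0 : 0 ≤ p.1) (hρ : rhoH p.1 p.2.1 < ‖p.2.2‖) :
    ContDiffAt ℝ n (fun p : ℝ × ℝ × E3 ↦ kOne p.1 p.2.1 p.2.2) p := by
  have hp := snd_snd_ne_zero_of_rhoH_lt hρ
  have hR := contDiffAt_param_qiRadius hp (n := n)
  have hS := contDiffAt_param_sigmaE hp (n := n)
  have ha := contDiffAt_param_snd_fst (n := n) (p := p)
  unfold kOne
  exact (((contDiffAt_param_fst.mul ha).mul ((hS.mul ((hR.pow 2).sub (ha.pow 2))).add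
    ((contDiffAt_const.mul (hR.pow 2)).mul ((hR.pow 2).add (ha.pow 2))))).neg).div
    ((contDiffAt_param_bigA hp).mul hS) (mul_ne_zero (bigA_pos h0 hρ).ne' (sigmaE_pos h0 hρ).ne')

/-- `k₂` is jointly smooth in `(M, a, y)` on the parameter region. [cite: BrandtSeidel1996, §II] -/
theorem contDiffAt_param_kTwo (h0 : 0 ≤ p.1) (hρ : rhoH p.1 p.2.1 < ‖p.2.2‖) :
    ContDiffAt ℝ n (fun p : ℝ × ℝ × E3 ↦ kTwo p.1 p.2.1 p.2.2) p := by
  have hp := snd_snd_ne_zero_of_rhoH_lt hρ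
  have hR := contDiffAt_param_qiRadius hp (n := n)
  have hS := contDiffAt_param_sigmaE hp (n := n)
  have ha := contDiffAt_param_snd_fst (n := n) (p := p)
  unfold kTwo
  exact ((((((contDiffAt_const.mul contDiffAt_param_fst).mul hR).mul (ha.pow 3)).mul
    (contDiffAt_param_div_norm hp)).mul (contDiffAt_param_delta_qiRadius hp)).neg).div
    ((contDiffAt_param_bigA hp).mul hS) (mul_ne_zero (bigA_pos h0 hρ).ne' (sigmaE_pos h0 hρ).ne')

/-- The radial differential `dR = (q/ρ) ρ⁻¹ ⟪y, ·⟫` is jointly smooth in `(M, a, y)` off `y = 0`.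
[cite: BrandtSeidel1996, §II] -/
theorem contDiffAt_param_dRCLM (hp : p.2.2 ≠ 0) :
    ContDiffAt ℝ n (fun p : ℝ × ℝ × E3 ↦ dRCLM p.1 p.2.1 p.2.2) p := by
  have hρ : ‖p.2.2‖ ≠ 0 := norm_ne_zero_iff.2 hp
  have hn := contDiffAt_param_norm hp (n := n)
  unfold dRCLM
  exact (((contDiffAt_param_qiRoot hp).div hn hρ).mul (hn.inv hρ)).smul contDiffAt_param_covec

/-- The rotational covector `ϖ` is jointly smooth (it does not depend on `(M, a)`) off `y = 0`.
[cite: BrandtSeidel1996, §II] -/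
theorem contDiffAt_param_rotFormCLM (hp : p.2.2 ≠ 0) :
    ContDiffAt ℝ ∞ (fun p : ℝ × ℝ × E3 ↦ rotFormCLM p.2.2) p :=
  (contDiffAt_rotFormCLM hp).comp p contDiffAt_param_snd_snd

/-- The latitude differential `dμ` is jointly smooth (it does not depend on `(M, a)`) off `y = 0`.
[folklore] -/
theorem contDiffAt_param_dMuCLM (hp : p.2.2 ≠ 0) :
    ContDiffAt ℝ ∞ (fun p : ℝ × ℝ × E3 ↦ dMuCLM p.2.2) p :=
  (contDiffAt_dMuCLM hp).comp p contDiffAt_param_snd_snd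

/-- The axial tensor `ϖ ⊗ ϖ` is jointly smooth (it does not depend on `(M, a)`) off `y = 0`.
[cite: BrandtSeidel1996, §II] -/
theorem contDiffAt_param_rotTensor (hp : p.2.2 ≠ 0) :
    ContDiffAt ℝ ∞ (fun p : ℝ × ℝ × E3 ↦ rotTensor p.2.2) p :=
  (contDiffAt_rotTensor hp).comp p contDiffAt_param_snd_snd

/-! ### The two closed forms, jointly in `(M, a, y)` -/

/-- **The Boyer–Lindquist slice metric `h_y = (Σ/ρ²)δ + (a²(Σ + 2MR)/Σ) ϖ ⊗ ϖ` is jointly smooth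
in `(M, a, y)`** at every point of the parameter region `0 ≤ M`, `‖y‖ > ρH(M, a)` (where `Σ > 0`),
as a map `ℝ × ℝ × E3 → (E3 →L[ℝ] E3 →L[ℝ] ℝ)`. Brandt–Seidel 1996, §II. [cite: BrandtSeidel1996, §II] -/
theorem contDiffAt_param_blHRepCLM (h0 : 0 ≤ p.1) (hρ : rhoH p.1 p.2.1 < ‖p.2.2‖) :
    ContDiffAt ℝ ∞ (fun p : ℝ × ℝ × E3 ↦ blHRepCLM p.1 p.2.1 p.2.2) p := by
  have hp := snd_snd_ne_zero_of_rhoH_lt hρ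
  have hρ0 : ‖p.2.2‖ ≠ 0 := norm_ne_zero_iff.2 hp
  have hn := contDiffAt_param_norm hp (n := ∞)
  have hR := contDiffAt_param_qiRadius hp (n := ∞)
  have hS : ContDiffAt ℝ ∞
      (fun p : ℝ × ℝ × E3 ↦ qiRadius p.1 p.2.1 ‖p.2.2‖ ^ 2 + p.2.1 ^ 2 * (p.2.2 2 / ‖p.2.2‖) ^ 2) p :=
    contDiffAt_param_sigmaE hp (n := ∞)
  have hS0 : qiRadius p.1 p.2.1 ‖p.2.2‖ ^ 2 + p.2.1 ^ 2 * (p.2.2 2 / ‖p.2.2‖) ^ 2 ≠ 0 :=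
    (sigmaE_pos h0 hρ).ne'
  unfold blHRepCLM
  exact contDiffAt_add' (F := E3 →L[ℝ] E3 →L[ℝ] ℝ)
    (contDiffAt_smul' (F := E3 →L[ℝ] E3 →L[ℝ] ℝ) (hS.div (hn.pow 2) (pow_ne_zero 2 hρ0))
      contDiffAt_const)
    (contDiffAt_smul' (F := E3 →L[ℝ] E3 →L[ℝ] ℝ)
      (((contDiffAt_param_snd_fst.pow 2).mul
        (hS.add ((contDiffAt_const.mul contDiffAt_param_fst).mul hR))).div hS hS0)
      (contDiffAt_param_rotTensor hp))

/-- **The Boyer–Lindquist second fundamental form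
`k_y = α⁻¹ (k₁ (dR ⊗ ϖ + ϖ ⊗ dR) + k₂ (dμ ⊗ ϖ + ϖ ⊗ dμ))` is jointly smooth in `(M, a, y)`** at
every point of the parameter region `0 ≤ M`, `‖y‖ > ρH(M, a)`, as a map
`ℝ × ℝ × E3 → (E3 →L[ℝ] E3 →L[ℝ] ℝ)`. Brandt–Seidel 1996, §II. [cite: BrandtSeidel1996, §II] -/
theorem contDiffAt_param_kRepCLM (h0 : 0 ≤ p.1) (hρ : rhoH p.1 p.2.1 < ‖p.2.2‖) :
    ContDiffAt ℝ ∞ (fun p : ℝ × ℝ × E3 ↦ kRepCLM p.1 p.2.1 p.2.2) p := by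
  have hp := snd_snd_ne_zero_of_rhoH_lt hρ
  have hdR := contDiffAt_param_dRCLM hp (n := ∞)
  have hrot := contDiffAt_param_rotFormCLM hp
  have hdM := contDiffAt_param_dMuCLM hp
  unfold kRepCLM
  exact contDiffAt_smul' (F := E3 →L[ℝ] E3 →L[ℝ] ℝ)
    ((contDiffAt_param_lapseE h0 hρ).inv (lapseE_pos h0 hρ).ne')
    (contDiffAt_add' (F := E3 →L[ℝ] E3 →L[ℝ] ℝ)
      (contDiffAt_smul' (F := E3 →L[ℝ] E3 →L[ℝ] ℝ) (contDiffAt_param_kOne h0 hρ)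
        (contDiffAt_add' (F := E3 →L[ℝ] E3 →L[ℝ] ℝ) (contDiffAt_smulRight' hdR hrot)
          (contDiffAt_smulRight' hrot hdR)))
      (contDiffAt_smul' (F := E3 →L[ℝ] E3 →L[ℝ] ℝ) (contDiffAt_param_kTwo h0 hρ)
        (contDiffAt_add' (F := E3 →L[ℝ] E3 →L[ℝ] ℝ) (contDiffAt_smulRight' hdM hrot)
          (contDiffAt_smulRight' hrot hdM))))

/-! ### Along parameter maps, and on the parameter region -/

/-- **The metric template along smooth parameter maps**: if `q ↦ M(q)`, `q ↦ a(q)`, `q ↦ y(q)` are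
`C^∞` at `q` with `0 ≤ M(q)`, `ρH(M(q), a(q)) < ‖y(q)‖`, then `q ↦ h^{M(q), a(q)}_{y(q)}` is `C^∞` at `q`
(the form consumed by a curve of rest templates with varying Kerr parameters).
[cite: BrandtSeidel1996, §II] -/
theorem contDiffAt_blHRepCLM_comp {P : Type*} [NormedAddCommGroup P] [NormedSpace ℝ P]
    {fM fa : P → ℝ} {fy : P → E3} {q : P} (hM : ContDiffAt ℝ ∞ fM q) (ha : ContDiffAt ℝ ∞ fa q)
    (hy : ContDiffAt ℝ ∞ fy q) (h0 : 0 ≤ fM q) (hρ : rhoH (fM q) (fa q) < ‖fy q‖) :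
    ContDiffAt ℝ ∞ (fun q ↦ blHRepCLM (fM q) (fa q) (fy q)) q := by
  have h := (contDiffAt_param_blHRepCLM (p := (fM q, fa q, fy q)) h0 hρ).comp q
    (hM.prodMk (ha.prodMk hy))
  exact h

/-- **The extrinsic template along smooth parameter maps** (same hypotheses).
[cite: BrandtSeidel1996, §II] -/
theorem contDiffAt_kRepCLM_comp {P : Type*} [NormedAddCommGroup P] [NormedSpace ℝ P]
    {fM fa : P → ℝ} {fy : P → E3} {q : P} (hM : ContDiffAt ℝ ∞ fM q) (ha : ContDiffAt ℝ ∞ fa q)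
    (hy : ContDiffAt ℝ ∞ fy q) (h0 : 0 ≤ fM q) (hρ : rhoH (fM q) (fa q) < ‖fy q‖) :
    ContDiffAt ℝ ∞ (fun q ↦ kRepCLM (fM q) (fa q) (fy q)) q := by
  have h := (contDiffAt_param_kRepCLM (p := (fM q, fa q, fy q)) h0 hρ).comp q
    (hM.prodMk (ha.prodMk hy))
  exact h

/-- The parameter region of the rest template: `0 ≤ M` and `‖y‖ > ρH(M, a)`. [cite: BrandtSeidel1996, §II] -/
theorem contDiffOn_param_blHRepCLM :
    ContDiffOn ℝ ∞ (fun p : ℝ × ℝ × E3 ↦ blHRepCLM p.1 p.2.1 p.2.2)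
      {p : ℝ × ℝ × E3 | 0 ≤ p.1 ∧ rhoH p.1 p.2.1 < ‖p.2.2‖} :=
  fun _ hp ↦ (contDiffAt_param_blHRepCLM hp.1 hp.2).contDiffWithinAt

/-- The same for the extrinsic closed form. [cite: BrandtSeidel1996, §II] -/
theorem contDiffOn_param_kRepCLM :
    ContDiffOn ℝ ∞ (fun p : ℝ × ℝ × E3 ↦ kRepCLM p.1 p.2.1 p.2.2)
      {p : ℝ × ℝ × E3 | 0 ≤ p.1 ∧ rhoH p.1 p.2.1 < ‖p.2.2‖} :=
  fun _ hp ↦ (contDiffAt_param_kRepCLM hp.1 hp.2).contDiffWithinAt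

/-- **Continuity of the threshold**: `(M, a) ↦ ρH(M, a) = √|M² − a²|/2` is continuous, so the
parameter region `{0 < M, ρH(M, a) < ‖y‖}` is open in `ℝ × ℝ × E3`. [cite: BrandtSeidel1996, §II] -/
theorem continuous_rhoH : Continuous fun p : ℝ × ℝ ↦ rhoH p.1 p.2 := by
  unfold rhoH
  fun_prop

/-- The open parameter region `{0 < M, ρH(M, a) < ‖y‖}` is open. [cite: BrandtSeidel1996, §II] -/
theorem isOpen_paramRegion :
    IsOpen {p : ℝ × ℝ × E3 | 0 < p.1 ∧ rhoH p.1 p.2.1 < ‖p.2.2‖} := by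
  refine (isOpen_lt continuous_const continuous_fst).inter (isOpen_lt ?_ (continuous_norm.comp ?_))
  · exact continuous_rhoH.comp (continuous_fst.prodMk (continuous_fst.comp continuous_snd))
  · exact continuous_snd.comp continuous_snd

end Kerr.BL

end Literature.Geometry.Lorentzian

end
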